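import Summits.HodgeConjecture.HodgeConjecture.Theorems.Ring2HypothesesDescentFibreClassDominated
import Summits.HodgeConjecture.HodgeConjecture.Theorems.Ring2AbelianAllAndreIsogenousPencils
import HarnessLib

/-!
# Ring 2 hypotheses, descent face — THE FIBRE-CLASS LEFSCHETZ NODE (β′) ASCENDS ALONG FIBREWISE ISOGENIES: (β′) for the
# TARGET pencil `f'` gives (β′) for the SOURCE `ψ ≫ f'` of every surjective `S`-morphism `ψ` of compact pencils of the same
# relative dimension — so (β′) is an invariant of a SINGLE isogeny (no isogeny back needed), with exact scalars

research route conditional on HC_CM; not a corollary; Q11.4-sentence-2 already refuted in dim ≥ 3.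
Cell `pub-hodge-ring2` (Hodge ladder STAGE 3), seat `ring2-b05` (binder row b05
`Ring2.Hypotheses.MotivatedImpliesAlgebraicAV`, published modulo X = `Ring2.AbelianAll.LefschetzBCompactPencils`), gen 44,
fifth file (companion of `Ring2HypothesesDescentFibreClassDominated`, which proved the DESCENT `(β′)(ψ ≫ f') ⟹ (β′)(f')` and
the invariance only under isogenies in BOTH directions). `HC_CM` does not occur in this file; nothing here proves a case of
the Hodge conjecture; no binder is discharged; (β′) stays OPEN and is displayed as a hypothesis only.

THE OBSERVATION. ab-andre-2 XXXIV-a (`Ring2AbelianAllAndreIsogenousPencils`, gen 26): for a surjective `S`-morphism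
`ψ : 𝒳 ⟶ 𝒳'` of compact pencils of abelian `d`-folds, `ψ^* ψ_!` is a non-zero scalar MODULO `ker j_t^*`, so transport and
lift ASCEND. For the exact operator identity of (β′) three scalars must moreover be UNIFORM in the fibre, and they are, by
the first file's uniform base change `ψ^* j'_{t*} = c · j_{t*} ψ_t^*` (`exists_map_fiberGysin_eq_smul_of_over`, (φ)) and the
degree trick `ψ_! ψ^* = c₃ · id`: (i) the FIBRE DEGREE `ψ_{t!} ψ_t^* = D · id` with `D = c₃ / c` for every `t` (apply `ψ_!` to
the uniform base change and read it on the fibre class `[𝒳'_t] ≠ 0`); (ii) the push-forward base change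
`j'^*_t ψ_! = K · ψ_{t!} j_t^*` with ONE `K = c₃ / D` (read XXXIII-e's fibrewise scalar on `u = 1`); (iii)
`j_t^*(ψ^* ψ_! W) = c₃ · j_t^* W` for every `t` (read XXXIV-a's scalar on `W = 1`). Then, given the algebraic correspondence
`T'` of `𝒳'` inverting `∪[𝒳'_t]` on fibre restrictions,

  `T := (K / c₃) · ψ^* ∘ T' ∘ ψ_!`

inverts `∪[𝒳_t]`: `ψ_!(j_{t*} j_t^* W) = j'_{t*} ψ_{t*} j_t^* W = K⁻¹ · j'_{t*} j'^*_t (ψ_! W)`, so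
`j_s^* T(j_{t*} j_t^* W) = (K/c₃) K⁻¹ · ψ_s^* j'^*_s T'(j'_{t*} j'^*_t ψ_! W) = c₃⁻¹ · ψ_s^* j'^*_s ψ_! W = c₃⁻¹ · j_s^* ψ^* ψ_! W = j_s^* W`.

* §1 `exists_fibreDegree_of_isogenous` (uniform fibre degree, `D ≠ 0`), `exists_map_fiberι_push_eq_smul_of_isogenous` (uniform
  push-forward base change, `K ≠ 0`), `map_fiberι_pull_push_eq_smul_of_isogenous` (`j_t^* ψ^* ψ_! = c₃ · j_t^*`, the `c₃` of
  `ψ_! ψ^* = c₃ · id`), `push_fiberGysin_eq` (`ψ_! ∘ j_{t*} = j'_{t*} ∘ ψ_{t*}`, functoriality).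
* §2 **`fibreClassLefschetzOn_of_isogenous_ascent` — (β′)(f') ⟹ (β′)(ψ ≫ f')**; **`fibreClassLefschetzOn_iff_of_isogenous` — (β′)
  IS AN INVARIANT OF ONE FIBREWISE ISOGENY** (with the second file's descent).

HONEST COLUMN. No definition, no named fact, no sorry. Per-pencil equivalence only: no node moves, no new pencil acquires (β′).
References: Abdulali1994FamiliesAV (Conj. 5.3 p. 1130); Fulton1998 (Thm. 6.2 (a), Example 1.7.4); VoisinHodgeI2002 (§7.3.2
Lemma 7.28, Remark 7.29); LangeBirkenhake1992 (Prop. 1.2.6: translations act trivially on cohomology); Tankeev2003 (Thm. 1.6,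
Remark 2.7: `B` along isogenies of abelian schemes over curves).
-/

noncomputable section

-- every declaration of this problem lives in `Summit.HodgeConjecture.HodgeConjecture.…` (summit = sub-problem)
set_option linter.dupNamespace false

open CategoryTheory CategoryTheory.Limits AlgebraicGeometry MonoidalCategory CartesianMonoidalCategory
open Literature.AlgebraicGeometry Literature.AlgebraicGeometry.Motives Literature.AlgebraicGeometry.HodgeTheory
open Literature.AlgebraicTopology.SingularHomology (singularCohomology)
open Summit.HodgeConjecture.HodgeConjecture.Ring2.AbelianAll

namespace Summit.HodgeConjecture.HodgeConjecture.Theorems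

variable {d : ℕ} {𝒳 𝒳' S : SchemeOver ℂ} {f' : 𝒳' ⟶ S} {ψ : 𝒳 ⟶ 𝒳'}

/-! ## §1 The three uniform scalars of a fibrewise isogeny -/

/-- **`ψ_! ∘ j_{t*} = j'_{t*} ∘ ψ_{t*}`** (functoriality of the Gysin morphisms along `j_t ≫ ψ = ψ_t ≫ j'_t`), written with the
tree's `fiberGysin`. [cite: FultonYoungTableaux1997, Appendix B §B.1 (5)] -/
theorem push_fiberGysin_eq (hf : IsCompactAbelianPencil (ψ ≫ f') d) (hf' : IsCompactAbelianPencil f' d) (t : ComplexPoints S)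
    (p : ℕ) (x : complexBetti (fiberOver (ψ ≫ f') t) (2 * p)) :
    complexGysin complexOrientationFamily hf.isSmoothProjective_total hf'.isSmoothProjective_total ψ
        (rfl : 2 * (p + 1) + 2 * (d + 1) = 2 * (p + 1) + 2 * (d + 1)) (fiberGysin hf t p x) =
      fiberGysin hf' t p (complexGysin complexOrientationFamily (hf.isSmoothProjective_fiberOver t)
        (hf'.isSmoothProjective_fiberOver t) (fiberOverMap ψ f' t) (rfl : 2 * p + 2 * d = 2 * p + 2 * d) x) := by
  have hPD : complexOrientationFamily.HasPoincareDuality := hasPoincareDuality_complexOrientationFamily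
  have h1 := LinearMap.congr_fun (complexGysin_comp hPD (hf.isSmoothProjective_fiberOver t) hf.isSmoothProjective_total
    hf'.isSmoothProjective_total (fiberι (ψ ≫ f') t) ψ (show 2 * p + 2 * (d + 1) = 2 * (p + 1) + 2 * d by omega)
    (show 2 * (p + 1) + 2 * (d + 1) = 2 * (p + 1) + 2 * (d + 1) from rfl)) x
  have h2 := LinearMap.congr_fun (complexGysin_comp hPD (hf.isSmoothProjective_fiberOver t) (hf'.isSmoothProjective_fiberOver t)
    hf'.isSmoothProjective_total (fiberOverMap ψ f' t) (fiberι f' t) (show 2 * p + 2 * d = 2 * p + 2 * d from rfl)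
    (show 2 * p + 2 * (d + 1) = 2 * (p + 1) + 2 * d by omega)) x
  rw [LinearMap.comp_apply] at h1 h2
  rw [fiberOverMap_comp_fiberι] at h2
  exact h1.symm.trans h2

/-- **UNIFORM FIBRE DEGREE: `ψ_{t*} ψ_t^* = D · id` on `H•(𝒳'_t(ℂ); ℂ)` with ONE `D ≠ 0` for all fibres** of a surjective
`S`-morphism `ψ` of compact pencils of abelian `d`-folds. Each fibre has its degree-trick scalar `D_t ≠ 0` (the tree's
`exists_complexGysin_map_eq_smul_of_surjective` for the surjective `ψ_t`); applying `ψ_!` to the first file's uniform base change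
`ψ^*[𝒳'_t] = c · j_{t*}(ψ_t^* 1)` gives `c₃ · [𝒳'_t] = c D_t · [𝒳'_t]` (`ψ_! ψ^* = c₃ · id`), and `[𝒳'_t] ≠ 0`, so `D_t = c₃ / c`.
[cite: VoisinHodgeI2002, §7.3.2 Remark 7.29] [cite: Fulton1998, Example 1.7.4 and §19.1] -/
theorem exists_fibreDegree_of_isogenous (hf : IsCompactAbelianPencil (ψ ≫ f') d) (hf' : IsCompactAbelianPencil f' d)
    [Surjective ψ.left] :
    ∃ D : ℂ, D ≠ 0 ∧ ∀ (t : ComplexPoints S) (k : ℕ) (y : complexBetti (fiberOver f' t) k),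
      complexGysin complexOrientationFamily (hf.isSmoothProjective_fiberOver t) (hf'.isSmoothProjective_fiberOver t)
        (fiberOverMap ψ f' t) (rfl : k + 2 * d = k + 2 * d) (complexBetti.map (fiberOverMap ψ f' t) k y) = D • y := by
  haveI : IsProper S.hom := IsSmoothProjective.isProper_holds hf'.isSmoothProjective_base
  obtain ⟨c, hc⟩ := exists_map_fiberGysin_eq_smul_of_over hf' hf
  obtain ⟨c₃, hc₃0, hc₃⟩ := exists_complexGysin_map_eq_smul_of_surjective complexOrientationFamily
    hf.isSmoothProjective_total hf'.isSmoothProjective_total ψ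
  -- `c ≠ 0`
  have hc0 : c ≠ 0 := by
    haveI := connectedSpace_complexPoints hf'.isSmoothProjective_base
    obtain ⟨t⟩ : Nonempty (ComplexPoints S) := inferInstance
    intro h0
    apply fiberGysin_one_ne_zero hf' t
    have h1 := hc t 0 (singularCohomology.one ℂ _)
    rw [h0, zero_smul] at h1
    have h2 := hc₃ (2 * (0 + 1)) (by omega) (fiberGysin hf' t 0 (singularCohomology.one ℂ _))
    rw [h1, map_zero] at h2
    exact (smul_eq_zero.1 h2.symm).resolve_left hc₃0
  refine ⟨c⁻¹ * c₃, mul_ne_zero (inv_ne_zero hc0) hc₃0, fun t k y ↦ ?_⟩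
  haveI := surjective_fiberOverMap_left f' ψ t
  obtain ⟨D, -, hD⟩ := exists_complexGysin_map_eq_smul_of_surjective complexOrientationFamily
    (hf.isSmoothProjective_fiberOver t) (hf'.isSmoothProjective_fiberOver t) (fiberOverMap ψ f' t)
  -- read `ψ_! ψ^* [𝒳'_t] = c₃ [𝒳'_t]` through the base change: `c₃ = c · D`
  have hcD : c * D = c₃ := by
    have h := hc₃ (2 * (0 + 1)) (by omega) (fiberGysin hf' t 0 (singularCohomology.one ℂ _))
    rw [hc t 0, map_smul, push_fiberGysin_eq hf hf' t 0, hD (2 * 0) rfl (singularCohomology.one ℂ _), map_smul, smul_smul] at h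
    exact smul_left_injective ℂ (fiberGysin_one_ne_zero hf' t) h
  rw [hD k rfl y, ← hcD, ← mul_assoc, inv_mul_cancel₀ hc0, one_mul]

/-- **UNIFORM PUSH-FORWARD BASE CHANGE: `j'^*_t(ψ_! u) = K · ψ_{t*}(j_t^* u)` with ONE `K ≠ 0` for all fibres** (XXXIII-e gives a
scalar `K_t` per fibre; on `u = 1`: `c₃ · 1 = j'^*_t ψ_! 1 = K_t · ψ_{t*} 1 = K_t D · 1` with `1 ≠ 0` in `H⁰(𝒳'_t)`, so
`K_t = c₃ / D`). [cite: Fulton1998, Thm. 6.2 (a)] [cite: VoisinHodgeI2002, §7.3.2 Remark 7.29] -/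
theorem exists_map_fiberι_push_eq_smul_of_isogenous (hf : IsCompactAbelianPencil (ψ ≫ f') d)
    (hf' : IsCompactAbelianPencil f' d) [Surjective ψ.left] :
    ∃ K : ℂ, K ≠ 0 ∧ ∀ (t : ComplexPoints S) (k : ℕ) (u : complexBetti 𝒳 k),
      complexBetti.map (fiberι f' t) k (complexGysin complexOrientationFamily hf.isSmoothProjective_total
          hf'.isSmoothProjective_total ψ (rfl : k + 2 * (d + 1) = k + 2 * (d + 1)) u) =
        K • complexGysin complexOrientationFamily (hf.isSmoothProjective_fiberOver t) (hf'.isSmoothProjective_fiberOver t)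
          (fiberOverMap ψ f' t) (rfl : k + 2 * d = k + 2 * d) (complexBetti.map (fiberι (ψ ≫ f') t) k u) := by
  haveI : IsProper S.hom := IsSmoothProjective.isProper_holds hf'.isSmoothProjective_base
  obtain ⟨c₃, hc₃0, hc₃⟩ := exists_complexGysin_map_eq_smul_of_surjective complexOrientationFamily
    hf.isSmoothProjective_total hf'.isSmoothProjective_total ψ
  obtain ⟨D, hD0, hD⟩ := exists_fibreDegree_of_isogenous hf hf'
  refine ⟨c₃ * D⁻¹, mul_ne_zero hc₃0 (inv_ne_zero hD0), fun t k u ↦ ?_⟩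
  obtain ⟨K, hK⟩ := exists_map_fiberι_push_gysin_eq_smul complexOrientationFamily hf.isSmoothProjective_total
    hf'.isSmoothProjective_total hf.isSmoothProjectiveFamily hf'.isSmoothProjectiveFamily t
  -- read `K` on `u = 1`: `K · D = c₃`
  have hKD : K * D = c₃ := by
    have h := hK (show 0 + 2 * (d + 1) = 0 + 2 * (d + 1) from rfl) (singularCohomology.one ℂ (ComplexPoints 𝒳))
    have hψ1 : complexBetti.map ψ 0 (singularCohomology.one ℂ (ComplexPoints 𝒳')) = singularCohomology.one ℂ (ComplexPoints 𝒳) :=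
      singularCohomology.map_one _
    rw [← hψ1, hc₃ 0 rfl, map_smul, map_fiberι_one f', map_fiberι_map_eq, map_fiberι_one f', hD t 0, smul_smul] at h
    exact (smul_left_injective ℂ (one_fiber_ne_zero complexOrientationFamily hf'.isSmoothProjectiveFamily t) h).symm
  rw [hK rfl u, ← hKD, mul_assoc, mul_inv_cancel₀ hD0, mul_one]

/-- **`j_t^*(ψ^* ψ_! W) = c₃ · j_t^* W` for EVERY fibre, with the `c₃` of `ψ_! ψ^* = c₃ · id`** (XXXIV-a gives a scalar `C_t ≠ 0`
per fibre; on `W = 1` it reads `C_t · 1 = c₃ · 1`). [cite: Fulton1998, Thm. 6.2 (a) and Example 1.7.4] [cite: LangeBirkenhake1992, Prop. 1.2.6] -/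
theorem map_fiberι_pull_push_eq_smul_of_isogenous (hf : IsCompactAbelianPencil (ψ ≫ f') d) (hf' : IsCompactAbelianPencil f' d)
    [Surjective ψ.left] {c₃ : ℂ}
    (hc₃ : ∀ (k : ℕ) (hab : k + 2 * (d + 1) = k + 2 * (d + 1)) (x : complexBetti 𝒳' k),
      complexGysin complexOrientationFamily hf.isSmoothProjective_total hf'.isSmoothProjective_total ψ hab
        (complexBetti.map ψ k x) = c₃ • x)
    (t : ComplexPoints S) (k : ℕ) (W : complexBetti 𝒳 k) :
    complexBetti.map (fiberι (ψ ≫ f') t) k (complexBetti.map ψ k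
        (complexGysin complexOrientationFamily hf.isSmoothProjective_total hf'.isSmoothProjective_total ψ
          (rfl : k + 2 * (d + 1) = k + 2 * (d + 1)) W)) =
      c₃ • complexBetti.map (fiberι (ψ ≫ f') t) k W := by
  haveI : IsProper S.hom := IsSmoothProjective.isProper_holds hf'.isSmoothProjective_base
  obtain ⟨C, -, hC⟩ := exists_map_fiberι_pull_push_eq_smul complexOrientationFamily hf.isSmoothProjective_total
    hf'.isSmoothProjective_total hf.isSmoothProjectiveFamily hf'.isSmoothProjectiveFamily t
    (finrank_complexBetti_fiber_eq_of_pencils hf hf' t)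
  -- read `C` on `W = 1`
  have hCc : C = c₃ := by
    have h := hC (show 0 + 2 * (d + 1) = 0 + 2 * (d + 1) from rfl) (singularCohomology.one ℂ (ComplexPoints 𝒳))
    have hψ1 : complexBetti.map ψ 0 (singularCohomology.one ℂ (ComplexPoints 𝒳')) = singularCohomology.one ℂ (ComplexPoints 𝒳) :=
      singularCohomology.map_one _
    rw [map_fiberι_one, ← hψ1, hc₃ 0 rfl, map_smul, map_smul, hψ1, map_fiberι_one] at h
    exact (smul_left_injective ℂ (one_fiber_ne_zero complexOrientationFamily hf.isSmoothProjectiveFamily t) h).symm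
  rw [hC rfl W, hCc]

/-! ## §2 (β′) ascends along fibrewise isogenies; (β′) is an invariant of one isogeny -/

/-- **(β′) ASCENDS ALONG FIBREWISE ISOGENIES.** Let `ψ : 𝒳 ⟶ 𝒳'` be a surjective `S`-morphism between compact pencils
`ψ ≫ f'`, `f'` of abelian `d`-folds. If `FibreClassLefschetzOn` holds for the TARGET `f'`, it holds for the SOURCE `ψ ≫ f'`:
`T := (K / c₃) · ψ^* ∘ T' ∘ ψ_!` with the uniform scalars of §1. No named fact.
[cite: Abdulali1994FamiliesAV, Conjecture 5.3 and Theorem 5.5 (p. 1130)] [cite: VoisinHodgeI2002, §7.3.2 Remark 7.29]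
[cite: Fulton1998, Thm. 6.2 (a) and §16.1 Prop. 16.1.1] -/
theorem fibreClassLefschetzOn_of_isogenous_ascent (hf : IsCompactAbelianPencil (ψ ≫ f') d) (hf' : IsCompactAbelianPencil f' d)
    [Surjective ψ.left] (h : FibreClassLefschetzOn hf') : FibreClassLefschetzOn hf := by
  haveI : IsProper S.hom := IsSmoothProjective.isProper_holds hf'.isSmoothProjective_base
  have hPD : complexOrientationFamily.HasPoincareDuality := hasPoincareDuality_complexOrientationFamily
  obtain ⟨c₃, hc₃0, hc₃⟩ := exists_complexGysin_map_eq_smul_of_surjective complexOrientationFamily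
    hf.isSmoothProjective_total hf'.isSmoothProjective_total ψ
  obtain ⟨K, hK0, hK⟩ := exists_map_fiberι_push_eq_smul_of_isogenous hf hf'
  intro p hp
  obtain ⟨T', hT'alg, hT'id⟩ := h p hp
  refine ⟨(K * c₃⁻¹) • ((complexBetti.map ψ (2 * p)).hom ∘ₗ T' ∘ₗ
      complexGysin complexOrientationFamily hf.isSmoothProjective_total hf'.isSmoothProjective_total ψ
        (rfl : 2 * (p + 1) + 2 * (d + 1) = 2 * (p + 1) + 2 * (d + 1))), ?_, fun W t s ↦ ?_⟩
  · -- algebraicity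
    refine IsAlgebraicCorrespondence.smul hf.isSmoothProjective_total hf.isSmoothProjective_total ?_ _
    refine IsAlgebraicCorrespondence.comp hf.isSmoothProjective_total hf'.isSmoothProjective_total
      hf.isSmoothProjective_total ?_ (isAlgebraicCorrespondence_map hf.isSmoothProjective_total hf'.isSmoothProjective_total
        ψ (by omega)) (by omega)
    exact IsAlgebraicCorrespondence.comp hf'.isSmoothProjective_total hf'.isSmoothProjective_total
      hf.isSmoothProjective_total (isAlgebraicCorrespondence_complexGysin complexOrientationFamily hPD
        hf.isSmoothProjective_total hf'.isSmoothProjective_total ψ _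
          (show 2 * (p + 1) + (2 * (d + 1) - 2 * (p + 1)) = 2 * (d + 1) by omega)) hT'alg (by omega)
  · -- `ψ_!(j_{t*} j_t^* W) = K⁻¹ · j'_{t*} j'^*_t (ψ_! W)`
    have h1 : complexGysin complexOrientationFamily hf.isSmoothProjective_total hf'.isSmoothProjective_total ψ
          (rfl : 2 * (p + 1) + 2 * (d + 1) = 2 * (p + 1) + 2 * (d + 1))
          (fiberGysin hf t p (complexBetti.map (fiberι (ψ ≫ f') t) (2 * p) W)) =
        K⁻¹ • fiberGysin hf' t p (complexBetti.map (fiberι f' t) (2 * p)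
          (complexGysin complexOrientationFamily hf.isSmoothProjective_total hf'.isSmoothProjective_total ψ
            (rfl : 2 * p + 2 * (d + 1) = 2 * p + 2 * (d + 1)) W)) := by
      rw [push_fiberGysin_eq hf hf' t p, hK t (2 * p) W, map_smul, smul_smul, inv_mul_cancel₀ hK0, one_smul]
    -- `j_s^* ψ^* = ψ_s^* j'^*_s`
    have h2 : ∀ u : complexBetti 𝒳' (2 * p), complexBetti.map (fiberι (ψ ≫ f') s) (2 * p) (complexBetti.map ψ (2 * p) u) =
        complexBetti.map (fiberOverMap ψ f' s) (2 * p) (complexBetti.map (fiberι f' s) (2 * p) u) :=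
      fun u ↦ map_fiberι_map_eq s (2 * p) u
    -- `j_s^* ψ^* ψ_! W = c₃ · j_s^* W`
    have h3 := map_fiberι_pull_push_eq_smul_of_isogenous hf hf' hc₃ s (2 * p) W
    rw [h2] at h3
    change complexBetti.map (fiberι (ψ ≫ f') s) (2 * p) ((K * c₃⁻¹) • complexBetti.map ψ (2 * p)
      (T' (complexGysin complexOrientationFamily hf.isSmoothProjective_total hf'.isSmoothProjective_total ψ _
        (fiberGysin hf t p (complexBetti.map (fiberι (ψ ≫ f') t) (2 * p) W))))) = _
    rw [map_smul, h1, map_smul, map_smul, map_smul, h2, hT'id, h3, smul_smul, smul_smul]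
    have hsc : K * c₃⁻¹ * K⁻¹ * c₃ = 1 := by
      field_simp
    rw [hsc, one_smul]

/-- **(β′) IS AN INVARIANT OF ONE FIBREWISE ISOGENY**: for a surjective `S`-morphism `ψ : 𝒳 ⟶ 𝒳'` of compact pencils of
abelian `d`-folds, `FibreClassLefschetzOn` holds for `ψ ≫ f'` iff it holds for `f'` (descent: second file; ascent: above).
FACT-FREE. [cite: Abdulali1994FamiliesAV, Conjecture 5.3 (p. 1130)] [cite: VoisinHodgeI2002, §7.3.2 Remark 7.29] -/
theorem fibreClassLefschetzOn_iff_of_isogenous (hf : IsCompactAbelianPencil (ψ ≫ f') d) (hf' : IsCompactAbelianPencil f' d)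
    [Surjective ψ.left] : FibreClassLefschetzOn hf ↔ FibreClassLefschetzOn hf' :=
  ⟨fibreClassLefschetzOn_of_dominant hf hf', fibreClassLefschetzOn_of_isogenous_ascent hf hf'⟩

end Summit.HodgeConjecture.HodgeConjecture.Theorems

end
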